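import Mathlib
import Literature.NumberTheory.EllipticCurves.IwasawaSelmer
import Literature.NumberTheory.EllipticCurves.PAdicHeightsK

/-!
# `stub_heegnerIndexLowerAtTwo` — stub-ideation k = 3 (gen 25): the CUT of H4 `AlgLowerK`
# (road B⁻'s residual research node) into five atoms A / B / C / L / E with a PROVED one-sided glue

Crux `SplitBadTwoLowerHalfOfFacts` (item `stmt-BirchSwinnertonDyer-27851`, route `PrintCf2`), stub
`stub_heegnerIndexLowerAtTwo` of the registered skeleton `kside_finite_two` v2. TECHNIQUE (k = 3, home
family 3 "probe the extremes", tool used = decomposition with a provable glue + per-key finite local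
table + autopsy of the odd-`p` proof): the node cut here is k2-g21's H4

  `AlgLowerKShape vlead vSha vReg vTam vD vtors δ :↔ 0 ≤ δ ∧ vlead ≤ vSha + vReg + vTam + vD − 2·vtors + δ`

— the ONE-SIDED ("Selmer side is at least as large as the leading term says") rank-one algebraic
leading-term inequality for the Greenberg (nearly-ordinary) dual Selmer module `X = X_Gr(W/K_cyc)` of the
CM curve `W = E_m ⊗ χ_e` (additive, potentially good ordinary at `2`) over the cyclotomic
`ℤ₂`-extension of the Heegner field `K`, which road B⁻ composes with MC⁻ (`L₂ ∣ char X`) and Disegni's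
`2`-adic Gross–Zagier (PRGZ₂) to get the stub's index inequality. Print covers `p` odd only
(Schneider 1985 p. 332; Perrin-Riou 1992 p. 137; Greenberg LNM 1716 §4 p. 110 "p is odd"; Delbourgo
2002 Thm (B), `p ≥ 5`, additive; Delbourgo 2008 p. 212 "`p ≥ 3`") and `p = 2` GOOD ordinary by a
different (two-variable, equivariant) machine (Li–Tian–Yan–Zhu 2025 §§3–5, 9).

THE CUT (all inequalities in ONE direction; nothing two-sided is claimed):

  `v(g(0))` ≤(A) `v#coker φ` ≤(G1, PROVED §1) `v#ker π + v[𝔐 : πφ(X^Γ)]`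
           ≤(B)  `[vSha_K + t₁ + t₂ + c_s] + …`,  `c_s ≤ vTam_K + a₁ + a₂`
           ≤(C)  `… + [c₀ + v h₂(P₀) − v log₂ κ(γ)]`

with `φ : X^Γ → X_Γ` the invariants-to-coinvariants map, `𝔐 = Hom(W(K) ⊗ ℤ₂, ℤ₂) ≅ ℤ₂` (rank one),
`π : X_Γ → 𝔐` the dual of Kummer-then-control, and the DYADIC LOCAL TABLE (atom L) of digits
`a_w, t_w, u_w` (`w ∣ 2`, two places) — each the `2`-adic valuation of the order of a FINITE group
named in §3. Atom E books the one-sided losses (`2·v#W(K)[2^∞]`, `v#ker φ`, `v#ker s`) honestly: they are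
dropped, never claimed.

* §1 — two index bricks on `AddSubgroup`s, PROVED from Mathlib (`relIndex_mul_index`,
  `relIndex_sup_left`, `relIndex_dvd_card`, `index_map`, `map_range`): G1 = "`#coker φ ≤ #ker π ·
  [C : (π ∘ φ)(A)]`".
* §2 — the digit-level glue `algLowerK_of_cut : A → G1 → B → C → L → AlgLowerKShape …`, PROVED
  (linear arithmetic), with `δ := t₁ + t₂ + a₁ + a₂ + c₀ + 2·vtors`, `vReg := v h₂(P₀) − v log₂ κ(γ)`,
  `vD := 0`; and its composition with the road-B⁻ shape of k2-g21 (`lower_index_form`-type budget).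
* §3 — TYPED atoms: A = the one-sided Perrin-Riou descent lemma over `Λ = IwasawaAlgebra p`
  (`Module.charIdeal`, `Submodule.torsionBy`, `QuotSMulTop` — real tree/Mathlib objects, any `p`);
  the K-side digits over tree receptacles (`(W.baseChange K).sha`, `tamagawaProduct`,
  `PAdicHeightDataK W 2 K`); B / C / L as `Prop`s over an explicit descent frame whose carrier groups
  are the ones the tree does not have yet (Greenberg local conditions at `w ∣ 2` for an additive
  potentially ordinary curve) — named, with their finiteness arguments, in the docstrings.

HONEST FRAMING. Nothing here proves BSD, the crux, the stub, or H4. The file elaborates with NO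
`sorry`; what is proved is index algebra and integer arithmetic; the atoms are `def … : Prop`
receptacles. `AlgLowerKShape` below is token-for-token k2-g21's (STUB_IDEAS_…_2_g21.lean §H4).
-/

set_option linter.dupNamespace false

noncomputable section

namespace Summit.BirchSwinnertonDyer.BirchSwinnertonDyer.Cruxes.SplitBadTwoLowerHalfOfFacts.StubIdeasK3G25

open Literature.NumberTheory.EllipticCurves
open scoped Pointwise

/-! ## §1 Index bricks (PROVED, Mathlib only) -/

section Bricks

variable {A B C : Type*} [AddCommGroup A] [AddCommGroup B] [AddCommGroup C]

/-- G1a. For subgroups `H, K ≤ B` with `K` finite: `[B : H] ≤ #K · [B : H + K]`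
(second isomorphism theorem `[H + K : H] = [K : H ∩ K] ∣ #K`). [folklore] -/
theorem index_le_card_mul_index_sup (H K : AddSubgroup B) [Finite K] :
    H.index ≤ Nat.card K * (H ⊔ K).index := by
  have h1 : H.relIndex (H ⊔ K) * (H ⊔ K).index = H.index :=
    AddSubgroup.relIndex_mul_index le_sup_left
  have h2 : H.relIndex (H ⊔ K) = H.relIndex K := AddSubgroup.relIndex_sup_left K H
  have h3 : H.relIndex K ≤ Nat.card K :=
    Nat.le_of_dvd Nat.card_pos (AddSubgroup.relIndex_dvd_card H K)
  calc H.index = H.relIndex K * (H ⊔ K).index := by rw [← h1, h2]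
    _ ≤ Nat.card K * (H ⊔ K).index := Nat.mul_le_mul_right _ h3

/-- G1b. For `π : B → C` and `H ≤ B`: `[B : H + ker π] ∣ [C : π(H)]`
(indeed `[C : π(H)] = [B : H + ker π] · [C : π(B)]`, Mathlib `AddSubgroup.index_map`). [folklore] -/
theorem index_sup_ker_dvd_index_map (π : B →+ C) (H : AddSubgroup B) :
    (H ⊔ π.ker).index ∣ (H.map π).index := by
  rw [AddSubgroup.index_map]
  exact dvd_mul_right _ _

/-- **G1 (the one-sided descent count).** For `φ : A → B`, `π : B → C` with `ker π` finite and
`(π ∘ φ)(A)` of finite index in `C`:  `#coker φ = [B : φ(A)] ≤ #ker π · [C : (π ∘ φ)(A)]`.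
Used with `A = X^Γ`, `B = X_Γ`, `C = 𝔐 = Hom(W(K) ⊗ ℤ₂, ℤ₂)`. [folklore] -/
theorem index_range_le_card_ker_mul_index_range_comp (φ : A →+ B) (π : B →+ C)
    [Finite π.ker] [hfi : (π.comp φ).range.FiniteIndex] :
    φ.range.index ≤ Nat.card π.ker * (π.comp φ).range.index := by
  have h := index_le_card_mul_index_sup φ.range π.ker
  have hd := index_sup_ker_dvd_index_map π φ.range
  rw [AddMonoidHom.map_range] at hd
  have hne : (π.comp φ).range.index ≠ 0 := hfi.index_ne_zero
  exact h.trans (Nat.mul_le_mul_left _ (Nat.le_of_dvd (Nat.pos_of_ne_zero hne) hd))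

/-- G1 in digits: if `#ker π ∣ 2^k` and `[C : (π∘φ)(A)] ∣ 2^c` then `[B : φ(A)] ≤ 2^(k+c)`. [folklore] -/
theorem index_range_le_two_pow (φ : A →+ B) (π : B →+ C)
    [Finite π.ker] [(π.comp φ).range.FiniteIndex] {k c : ℕ}
    (hk : Nat.card π.ker ∣ 2 ^ k) (hc : (π.comp φ).range.index ∣ 2 ^ c) :
    φ.range.index ≤ 2 ^ (k + c) := by
  have h := index_range_le_card_ker_mul_index_range_comp φ π
  have hk' : Nat.card π.ker ≤ 2 ^ k := Nat.le_of_dvd (by positivity) hk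
  have hc' : (π.comp φ).range.index ≤ 2 ^ c := Nat.le_of_dvd (by positivity) hc
  calc φ.range.index ≤ Nat.card π.ker * (π.comp φ).range.index := h
    _ ≤ 2 ^ k * 2 ^ c := Nat.mul_le_mul hk' hc'
    _ = 2 ^ (k + c) := (pow_add 2 k c).symm

end Bricks

/-! ## §2 The digit-level glue (PROVED): A → G1 → B → C → L → `AlgLowerKShape` -/

/-- k2-g21's H4 shape, token for token (`STUB_IDEAS_stub_heegnerIndexLowerAtTwo_2_g21.lean`, §H4):
the one-sided rank-one leading-term inequality with an explicit non-negative slack `δ`. -/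
def AlgLowerKShape (vlead vSha vReg vTam vD vtors δ : ℤ) : Prop :=
  0 ≤ δ ∧ vlead ≤ vSha + vReg + vTam + vD - 2 * vtors + δ

/-- The digits of the cut (all `2`-adic valuations of orders of FINITE groups or of non-zero
`2`-adic numbers; see §3 for the groups):
* `vlead = v([T¹] f)`, `f` a generator of `char_Λ X_Gr(W/K_cyc)`;
* `cφ = v#coker(φ : X^Γ → X_Γ)`; `kπ = v#ker(π : X_Γ → 𝔐)`; `cψ = v[𝔐 : (π∘φ)(X^Γ)]`;
* `cs = v#coker(s : Sel_Gr(W/K) → Sel_Gr(W/K_cyc)^Γ)` (control);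
* `vSha = v#Ш(W/K)[2^∞]`, `vTam = v ∏_w c_w(W/K)`, `vtors = v#W(K)[2^∞]`;
* `t₁, t₂` (`w ∣ 2`): `v#(L^Gr_w / (L^Gr_w)_div)`, the cotorsion of Greenberg's local condition;
* `a₁, a₂` (`w ∣ 2`): `v#ker(H¹(K_w, A)/L^Gr_w → H¹(K_cyc,w, A)/L^Gr_{w,∞})`, the dyadic control kernels;
* `c₀ ≥ 0`: the exponent in atom C (`im(π∘φ) ⊇ 2^{c₀} · im h_T`), predicted `≤ u₁ + u₂ +` admissible index,
  `u_w = v[W(K_w) : N_∞ W(K_w)]` the universal-norm index;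
* `vh = v(h₂(P₀, P₀))` for a generator `P₀` of `W(K)/tors` and THE canonical cyclotomic `2`-adic height
  over `K` (`PAdicHeightDataK W 2 K`, `IsCanonicalSq`); `vlogγ = v(log₂ κ(γ)) = 2`. -/
structure CutDigits where
  (vlead cφ kπ cψ cs vSha vTam vtors t₁ t₂ a₁ a₂ c₀ vh vlogγ : ℤ)

namespace CutDigits

variable (d : CutDigits)

/-- Atom **A** (one-sided Perrin-Riou descent lemma, digits): `v(g(0)) = v#coker φ − v#ker φ ≤ v#coker φ`. -/
def AtomA : Prop := d.vlead ≤ d.cφ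

/-- Brick **G1** (PROVED in §1 at group level), digits: `v#coker φ ≤ v#ker π + v[𝔐 : πφ(X^Γ)]`. -/
def BrickG1 : Prop := d.cφ ≤ d.kπ + d.cψ

/-- Atom **B** (control⁻, digits): (i) `ker π = (X_Γ)_tors`, `#(X_Γ)_tors = #(Sel_Gr(K_cyc)^Γ/div)
≤ #(Sel_Gr(K)/div) · #coker s ≤ #Ш(W/K)[2^∞] · 2^{t₁+t₂} · #coker s`; (ii) snake lemma + `cd₂ Γ = 1`:
`#coker s ≤ ∏_{w ∈ Σ} #ker r_w`, with `#ker r_w = c_w^{(2)}` at `w ∤ 2` (Greenberg LNM 1716 Lemma 3.3,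
tree `Greenberg1999.lemma33_*`, ALL `p`) and `= 2^{a_w}` at `w ∣ 2`. -/
def AtomB : Prop := d.kπ ≤ d.vSha + d.t₁ + d.t₂ + d.cs ∧ d.cs ≤ d.vTam + d.a₁ + d.a₂

/-- Atom **C** (Bockstein ⊇ height, digits — the research-M heart at `p = 2`):
`v[𝔐 : πφ(X^Γ)] ≤ c₀ + v h₂(P₀,P₀) − v log₂ κ(γ)`, `0 ≤ c₀`. -/
def AtomC : Prop := d.cψ ≤ d.c₀ + d.vh - d.vlogγ ∧ 0 ≤ d.c₀

/-- Atom **L** (dyadic local table): the four local digits are valuations of orders of finite groups,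
hence `≥ 0` (their VALUES — predicted `a_w = 1` — are the per-key certified computation). -/
def AtomL : Prop := 0 ≤ d.t₁ ∧ 0 ≤ d.t₂ ∧ 0 ≤ d.a₁ ∧ 0 ≤ d.a₂

/-- Atom **E** (bookkeeping): torsion valuation is non-negative (it is only ever DROPPED). -/
def AtomE : Prop := 0 ≤ d.vtors

/-- The slack of the cut. -/
def delta : ℤ := d.t₁ + d.t₂ + d.a₁ + d.a₂ + d.c₀ + 2 * d.vtors

/-- **THE GLUE (PROVED).** A ∧ G1 ∧ B ∧ C ∧ L ∧ E ⟹ H4 `AlgLowerKShape` with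
`vReg := vh − vlogγ`, `vD := 0`, `δ := t₁ + t₂ + a₁ + a₂ + c₀ + 2·vtors`. -/
theorem algLowerK_of_cut (hA : d.AtomA) (hG : d.BrickG1) (hB : d.AtomB) (hC : d.AtomC)
    (hL : d.AtomL) (hE : d.AtomE) :
    AlgLowerKShape d.vlead d.vSha (d.vh - d.vlogγ) d.vTam 0 d.vtors d.delta := by
  unfold AtomA at hA; unfold BrickG1 at hG; unfold AtomB at hB; unfold AtomC at hC
  unfold AtomL at hL; unfold AtomE at hE
  obtain ⟨hB1, hB2⟩ := hB
  obtain ⟨hC1, hC2⟩ := hC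
  obtain ⟨hL1, hL2, hL3, hL4⟩ := hL
  refine ⟨?_, ?_⟩
  · unfold delta; omega
  · unfold delta; omega

/-- The glue is TIGHT as bookkeeping: with all one-sided losses zero the bound is the print-shaped
equality's `≤` half (sanity instance: `vlead = vSha + vReg + vTam − 0 + (t+a+c₀)` is allowed). -/
example : AlgLowerKShape 5 1 2 2 0 0 0 := by unfold AlgLowerKShape; omega

/-- **Composition with road B⁻** (shape of k2-g5 `lower_of_roadB` / k2-g21 `lower_of_disegni_mc_alg`):
MC⁻ (`L₂ ∣ f`, so `v(lead L₂) ≤ … ` no — `f = L₂ · u` gives `v(lead f) ≥ v(lead L₂)`) and PRGZ₂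
(`v(lead L₂) = 2ι − 2vc + vh − vlogγ + ν`, `ν ≥ 0` Disegni's algebraic-part digit) turn H4 into the
stub-shaped lower bound `2ι − 2vc ≤ vSha + vTam + δ − ν' …`. PROVED arithmetic. -/
theorem lower_index_of_cut (ι vc ν : ℤ)
    (hH4 : AlgLowerKShape d.vlead d.vSha (d.vh - d.vlogγ) d.vTam 0 d.vtors d.delta)
    (hMC : 2 * ι - 2 * vc + (d.vh - d.vlogγ) + ν ≤ d.vlead) (hν : 0 ≤ ν) :
    2 * ι - 2 * vc ≤ d.vSha + d.vTam + (d.delta - 2 * d.vtors) := by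
  obtain ⟨_, h⟩ := hH4
  omega

/-- The budget line (B8): the stub's inequality `2ι − 2vc ≤ vSha + vTam` follows from the cut iff the
net slack `t₁ + t₂ + a₁ + a₂ + c₀` is absorbed by Disegni's digit `ν` — the finite per-key check. -/
theorem stub_shape_of_cut (ι vc ν : ℤ)
    (hH4 : AlgLowerKShape d.vlead d.vSha (d.vh - d.vlogγ) d.vTam 0 d.vtors d.delta)
    (hMC : 2 * ι - 2 * vc + (d.vh - d.vlogγ) + ν ≤ d.vlead)
    (hbudget : d.t₁ + d.t₂ + d.a₁ + d.a₂ + d.c₀ ≤ ν) :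
    2 * ι - 2 * vc ≤ d.vSha + d.vTam := by
  obtain ⟨_, h⟩ := hH4
  unfold delta at h
  omega

end CutDigits

/-! ## §3 Typed atoms -/

section AtomATyped

variable (p : ℕ) [Fact p.Prime]

/-- The invariants-to-coinvariants map `φ : X^Γ = X[T] → X_Γ = X/TX` of a `Λ = ℤ_p⟦T⟧`-module
(`T = γ − 1`), in Mathlib vocabulary (`Submodule.torsionBy`, `QuotSMulTop`). -/
def invToCoinv (X : Type*) [AddCommGroup X] [Module (IwasawaAlgebra p) X] :
    Submodule.torsionBy (IwasawaAlgebra p) X (PowerSeries.X : IwasawaAlgebra p) →ₗ[IwasawaAlgebra p]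
      QuotSMulTop (PowerSeries.X : IwasawaAlgebra p) X :=
  ((PowerSeries.X : IwasawaAlgebra p) • (⊤ : Submodule (IwasawaAlgebra p) X)).mkQ ∘ₗ
    (Submodule.torsionBy (IwasawaAlgebra p) X (PowerSeries.X : IwasawaAlgebra p)).subtype

/-- **Atom A, typed (one-sided Perrin-Riou descent lemma, rank one, ANY prime `p`).** Let `X` be a
finitely generated torsion `Λ`-module with `char_Λ X = (f)`, and suppose the coinvariants `X_Γ` have
`ℤ_p`-rank one, witnessed group-theoretically by an additive map `π : X_Γ → ℤ_p` with finite kernel and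
image of finite index (in the application `π` is the dual of Kummer-then-control into
`𝔐 = Hom(W(K) ⊗ ℤ_p, ℤ_p)`). If `coker φ` is finite of order dividing `p^c`, then `f = T · g` with
`g(0) ≠ 0` and `v_p(g(0)) ≤ c` (print: `g(0) ∼ #coker φ / #ker φ`, the kernel being automatically
finite). Perrin-Riou, Mém. SMF 17 (1984) §I Lemme 5 / Invent. Math. 109 (1992) §1; Greenberg LNM 1716
§4 pp. 107–110 (rank-one computation of `g_E(0)`); used at `p = 2` verbatim — the lemma is pure
`Λ`-algebra. Tree tools toward a proof: `Module.charIdeal`, `charIdeal_mul_of_shortExact`,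
`charIdeal_quotSMulTop`-type lemmas in `IwasawaAlgebra*.lean`. Receptacle, nothing asserted. -/
def DescentLemmaOneSidedRankOne : Prop :=
  ∀ (X : Type) [AddCommGroup X] [Module (IwasawaAlgebra p) X] [Module.Finite (IwasawaAlgebra p) X],
    Module.IsTorsion (IwasawaAlgebra p) X →
  ∀ (f : IwasawaAlgebra p), Module.charIdeal (IwasawaAlgebra p) X = Ideal.span {f} →
  ∀ (π : QuotSMulTop (PowerSeries.X : IwasawaAlgebra p) X →+ ℤ_[p]),
    Finite π.ker → π.range.FiniteIndex →
  ∀ (c : ℕ), Nat.card (QuotSMulTop (PowerSeries.X : IwasawaAlgebra p) X ⧸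
      (LinearMap.range (invToCoinv p X)).toAddSubgroup) ∣ p ^ c →
    ∃ g : IwasawaAlgebra p, f = PowerSeries.X * g ∧
      PowerSeries.constantCoeff g ≠ 0 ∧
      ¬ ((p : ℤ_[p]) ^ (c + 1) ∣ PowerSeries.constantCoeff g)

end AtomATyped

section KSideTyped

open WeierstrassCurve

variable (W : WeierstrassCurve ℚ) (K : Type) [Field K] [NumberField K]

/-- The K-side digits the stub already names, as tree terms (valuations at `2`):
`vSha = v#Ш(W/K)[2^∞]`, `vTam = v ∏_w c_w(W/K)`. -/
def vShaK : ℤ := (padicValNat 2 (Nat.card (AddCommGroup.primaryComponent (W.baseChange K).sha 2)) : ℤ)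

/-- `vTam_K = v₂(∏_w c_w(W/K))` (the stub's `tamagawaProduct` term). -/
def vTamK : ℤ := (padicValNat 2 (W.baseChange K).tamagawaProduct : ℤ)

/-- `vh = v₂(h₂(P₀, P₀))` for a `2`-adic height datum over `K` (the receptacle the road uses for
Disegni's / the canonical cyclotomic height: `PAdicHeightDataK W 2 K`, pinned by `IsCanonicalSq`). -/
def vHeight (DK : PAdicHeightDataK W 2 K) (P₀ : (W.baseChange K).toAffine.Point) : ℤ :=
  (DK.height P₀).valuation

/-- `vlead = v₂([T¹] f)` for `f : Λ = ℤ₂⟦T⟧`. -/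
def vLead (f : IwasawaAlgebra 2) : ℤ := ((PowerSeries.coeff 1 f : ℤ_[2]) : ℚ_[2]).valuation

/-- **H4 at `p = 2`, typed over the tree's K-side receptacles, CONDITIONAL on the atoms (digits).**
For every Greenberg dual Selmer carrier `X` (a f.g. torsion `Λ`-module — the tree has the classical
`(W.baseChange K).SelmerDualData κ γ`; the nearly-ordinary one at additive `w ∣ 2` is the frame's
missing receptacle, so `X` is abstract here) with `char X = (f)`, every canonical height datum and
generator `P₀`: the atoms imply `AlgLowerKShape (v [T¹]f) vSha_K (vh − 2) vTam_K 0 vtors δ`.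
PROVED from §2 (it is the glue read on tree terms); the content is in discharging the atom hypotheses. -/
theorem h4_typed_of_cut (f : IwasawaAlgebra 2) (DK : PAdicHeightDataK W 2 K)
    (P₀ : (W.baseChange K).toAffine.Point) (d : CutDigits)
    (hlead : d.vlead = vLead f) (hSha : d.vSha = vShaK W K) (hTam : d.vTam = vTamK W K)
    (hh : d.vh = vHeight W K DK P₀) (hlog : d.vlogγ = 2)
    (hA : d.AtomA) (hG : d.BrickG1) (hB : d.AtomB) (hC : d.AtomC) (hL : d.AtomL) (hE : d.AtomE) :
    AlgLowerKShape (vLead f) (vShaK W K) (vHeight W K DK P₀ - 2) (vTamK W K) 0 d.vtors d.delta := by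
  have h := d.algLowerK_of_cut hA hG hB hC hL hE
  rw [hlead, hSha, hTam, hh, hlog] at h
  exact h

end KSideTyped

section FrameTyped

/-- **The descent frame of road B⁻ at `p = 2`** (abstract carriers; the typed homes are named per field).
This is where B11 (finiteness) is discharged: every digit of `CutDigits` is `padicValNat 2 (Nat.card _)`
of one of these groups, and each is FINITE for the six dyadic keys by the argument in its docstring. -/
structure DescentFrame where
  /-- `X^Γ` (invariants of the Greenberg dual Selmer module `X_Gr(W/K_cyc)`). -/
  XΓ : Type
  /-- `X_Γ` (coinvariants). -/
  Xco : Type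
  /-- `𝔐 = Hom(W(K) ⊗ ℤ₂, ℤ₂)`, free of rank one. -/
  M : Type
  [iXΓ : AddCommGroup XΓ] [iXco : AddCommGroup Xco] [iM : AddCommGroup M]
  /-- `φ : X^Γ → X_Γ`. -/
  φ : XΓ →+ Xco
  /-- `π : X_Γ → 𝔐`, dual of `W(K) ⊗ ℚ₂/ℤ₂ → Sel_Gr(W/K) → Sel_Gr(W/K_cyc)^Γ`. -/
  π : Xco →+ M
  /-- `ker π = (X_Γ)_tors` is finite (rank count: `X_Γ` and `𝔐` have `ℤ₂`-rank one, `coker π` finite). -/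
  [finKer : Finite π.ker]
  /-- `[𝔐 : πφ(X^Γ)] < ∞` (⟸ non-degeneracy of `h₂` on `W(K)`, rank one: Bertrand — road B⁻'s node D1). -/
  [finIdx : (π.comp φ).range.FiniteIndex]

attribute [instance] DescentFrame.iXΓ DescentFrame.iXco DescentFrame.iM DescentFrame.finKer
  DescentFrame.finIdx

/-- The frame's two group-level digits bound the cokernel digit: this is §1's G1 read on the frame
(PROVED) — so `BrickG1` is never a hypothesis in earnest, only atoms A/B/C/L are. -/
theorem DescentFrame.coker_le (F : DescentFrame) {k c : ℕ}
    (hk : Nat.card F.π.ker ∣ 2 ^ k) (hc : (F.π.comp F.φ).range.index ∣ 2 ^ c) :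
    F.φ.range.index ≤ 2 ^ (k + c) :=
  index_range_le_two_pow F.φ F.π hk hc

end FrameTyped

end Summit.BirchSwinnertonDyer.BirchSwinnertonDyer.Cruxes.SplitBadTwoLowerHalfOfFacts.StubIdeasK3G25

end
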